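import Summits.KontsevichZagierPeriods.KontsevichZagierPeriods.Theorems.IsogenyCertificatesGenusTwoRealPeriodCellStubFibreEqTwo
import Summits.KontsevichZagierPeriods.KontsevichZagierPeriods.Theorems.IsogenyCertificatesGenusTwoRealPeriodCellStubBandNLCell

/-!
# `GenusTwoRealPeriodCell` (stmt-KontsevichZagierPeriods-17657), line `Sketch`: the engine
# `stub_bandNewtonLeibniz` — Newton–Leibniz down a band, off a null exceptional set

For a closed band `{a₀ ≤ x ≤ a₁, α x ≤ y ≤ β x}` (rational `a₀ < a₁`, `ℚ`-semialgebraic `α ≤ β` on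
`(a₀, a₁)`), a `ℚ`-semialgebraic bounded `F` on the band, continuous on every closed fibre and with
`∂F/∂y = r.integrand` at every point of the open fibres outside a `ℚ`-semialgebraic null set `Z`, the
band representation `r` differs by Kontsevich–Zagier relations from the base representation
`[∫_{(a₀,a₁)} F(x, β x) − F(x, α x) dx]`.

Proof: take a cylindrical decomposition of `ℝ¹` adapted to both `U \ Z` and `U ∩ Z`, `U` the open
band (`stub_fibreEqTwo`); cut `r` along the cylinders over its cells and `r'` along the cells
(rule 1a, `KZ.of_sub_sum_cyl_mem_relations`, `KZ.of_sub_sum_of_mem_relations`); over each cell the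
two pieces differ by relations (`stub_bandNLCell`: null cells carry null pieces; over a positive cell the
closed sub-bands cover the band piece up to null graphs, go down by one Newton–Leibniz move each, and
their base integrands telescope). This is verbatim the open engine stub `stub_bandNewtonLeibniz` of
crux `PlanarAreas` (stmt-4990), line `green-native-bands`.

References: M. Kontsevich, D. Zagier, *Periods* (2001), §1.2 rules (1), (3); S. Basu, R. Pollack,
M.-F. Roy, *Algorithms in Real Algebraic Geometry* (2006), Cor. 5.7.
-/

noncomputable section

open scoped BigOperators Topology ENNReal
open Set MeasureTheory Filter
open Literature.NumberTheory.Transcendental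
open Literature.ModelTheory.ExponentialFields (IsSemialgebraic IsCylindricalDecomposition graphOver bandOver bandLower bandUpper tarski_seidenberg_real_holds)

namespace Summit.KontsevichZagierPeriods.IsogenyCertificates.GenusTwoRealPeriodCellLine

/-- **The open band with semialgebraic edges is semialgebraic**: for `ℚ`-semialgebraic
`x ↦ α x`, `x ↦ β x` on the strip `{a₀ < x < a₁} ⊆ ℝ¹`, the set
`{p ∈ ℝ² | a₀ < p 0 < a₁, α (p 0) < p 1 < β (p 0)}` is `ℚ`-semialgebraic (cylinder over the strip
minus the closed hypograph of `α` and the closed epigraph of `β`, by graph elimination).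
[cite: BochnakCosteRoy1998, §2.2] -/
theorem isSemialgebraic_openBand {a₀ a₁ : ℝ} {α β : ℝ → ℝ}
    (hα : IsSemialgebraicFunOn ℚ {z : Fin 1 → ℝ | z 0 ∈ Ioo a₀ a₁} (fun z => α (z 0)))
    (hβ : IsSemialgebraicFunOn ℚ {z : Fin 1 → ℝ | z 0 ∈ Ioo a₀ a₁} (fun z => β (z 0))) :
    IsSemialgebraic ℚ {p : Fin 2 → ℝ | p 0 ∈ Ioo a₀ a₁ ∧ α (p 0) < p 1 ∧ p 1 < β (p 0)} := by
  have hstrip : IsSemialgebraic ℚ {z : Fin 1 → ℝ | z 0 ∈ Ioo a₀ a₁} :=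
    IsSemialgebraicFunOn.isSemialgebraic_holds hα
  have hcyl : IsSemialgebraic ℚ {p : Fin 2 → ℝ | Fin.init p ∈ {z : Fin 1 → ℝ | z 0 ∈ Ioo a₀ a₁}} :=
    hstrip.setOf_init_mem
  have hle := hα.isSemialgebraic_setOf_le tarski_seidenberg_real_holds
  have hge := hβ.isSemialgebraic_setOf_ge tarski_seidenberg_real_holds
  convert hcyl.diff (hle.union hge) using 1
  ext p
  have h0 : Fin.init p 0 = p 0 := rfl
  have h1 : p (Fin.last 1) = p 1 := rfl
  simp only [mem_setOf_eq, Set.mem_sdiff, mem_union, h0, h1, not_or, not_and, not_le]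
  constructor
  · rintro ⟨hp, h2, h3⟩
    exact ⟨hp, fun _ => h2, fun _ => h3⟩
  · rintro ⟨hp, h2, h3⟩
    exact ⟨hp, h2 hp, h3 hp⟩

/-- **The base representation of the engine exists**: on the strip `(a₀, a₁) ⊆ ℝ¹` the integrand
`x ↦ F(x, β x) − F(x, α x)` is `ℚ`-semialgebraic (composition of `F` with the semialgebraic sections)
and integrable (bounded by `2M` on a set of finite measure). [cite: KontsevichZagier2001, §1.1] -/
theorem exists_baseRep {a₀ a₁ : ℚ} {α β : ℝ → ℝ} {F : (Fin 2 → ℝ) → ℝ} {r : KZ.IntegralRep 2}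
    (hα : IsSemialgebraicFunOn ℚ {z : Fin 1 → ℝ | z 0 ∈ Ioo (a₀ : ℝ) a₁} (fun z => α (z 0)))
    (hβ : IsSemialgebraicFunOn ℚ {z : Fin 1 → ℝ | z 0 ∈ Ioo (a₀ : ℝ) a₁} (fun z => β (z 0)))
    (hαβ : ∀ t ∈ Ioo (a₀ : ℝ) a₁, α t ≤ β t)
    (hdom : r.domain = {p : Fin 2 → ℝ | p 0 ∈ Icc (a₀ : ℝ) a₁ ∧ α (p 0) ≤ p 1 ∧ p 1 ≤ β (p 0)})
    (hF : IsSemialgebraicFunOn ℚ r.domain F) (hM : ∃ M : ℝ, ∀ p ∈ r.domain, |F p| ≤ M) :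
    ∃ r' : KZ.IntegralRep 1, r'.domain = {z : Fin 1 → ℝ | z 0 ∈ Ioo (a₀ : ℝ) a₁} ∧
      ∀ z ∈ r'.domain, r'.integrand z = F ![z 0, β (z 0)] - F ![z 0, α (z 0)] := by
  obtain ⟨M, hM⟩ := hM
  set strip : Set (Fin 1 → ℝ) := {z : Fin 1 → ℝ | z 0 ∈ Ioo (a₀ : ℝ) a₁} with hstrip_def
  have hstrip : IsSemialgebraic ℚ strip := IsSemialgebraicFunOn.isSemialgebraic_holds hα
  have hstripm : MeasurableSet strip :=
    Literature.ModelTheory.ExponentialFields.IsSemialgebraic.measurableSet_holds hstrip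
  have hmemr : ∀ z ∈ strip, ∀ t, α (z 0) ≤ t → t ≤ β (z 0) → (Fin.snoc z t : Fin 2 → ℝ) ∈ r.domain := by
    intro z hz t h1 h2
    rw [hdom]
    exact ⟨Ioo_subset_Icc_self hz, h1, h2⟩
  have hβmem : ∀ z ∈ strip, (Fin.snoc z (β (z 0)) : Fin 2 → ℝ) ∈ r.domain := fun z hz =>
    hmemr z hz _ (hαβ _ hz) le_rfl
  have hαmem : ∀ z ∈ strip, (Fin.snoc z (α (z 0)) : Fin 2 → ℝ) ∈ r.domain := fun z hz =>
    hmemr z hz _ le_rfl (hαβ _ hz)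
  have hFβ : IsSemialgebraicFunOn ℚ strip (fun z => F (Fin.snoc z (β (z 0)))) :=
    IsSemialgebraicFunOn.comp_isSemialgebraicMapOn_holds hF (subband_isSemialgebraicMapOn_snoc hstrip hβ)
      fun z hz => hβmem z hz
  have hFα : IsSemialgebraicFunOn ℚ strip (fun z => F (Fin.snoc z (α (z 0)))) :=
    IsSemialgebraicFunOn.comp_isSemialgebraicMapOn_holds hF (subband_isSemialgebraicMapOn_snoc hstrip hα)
      fun z hz => hαmem z hz
  have hg : IsSemialgebraicFunOn ℚ strip
      (fun z => F (Fin.snoc z (β (z 0))) - F (Fin.snoc z (α (z 0)))) :=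
    IsSemialgebraicFunOn.sub_holds hFβ hFα
  have hint : IntegrableOn (fun z => F (Fin.snoc z (β (z 0))) - F (Fin.snoc z (α (z 0)))) strip := by
    refine IntegrableOn.of_bound (subband_volume_lt_top_of_subset_strip subset_rfl)
      (KZ.aestronglyMeasurable_of_isSemialgebraicFunOn hg hstripm) (M + M) ?_
    exact (ae_restrict_mem hstripm).mono fun z hz => (norm_sub_le _ _).trans
      (add_le_add (by rw [Real.norm_eq_abs]; exact hM _ (hβmem z hz))
        (by rw [Real.norm_eq_abs]; exact hM _ (hαmem z hz)))
  refine ⟨⟨strip, fun z => F (Fin.snoc z (β (z 0))) - F (Fin.snoc z (α (z 0))), hstrip, hg, hint⟩,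
    rfl, fun z _ => ?_⟩
  have h := subband_fibreFun_eq F z
  show F (Fin.snoc z (β (z 0))) - F (Fin.snoc z (α (z 0))) = _
  rw [show F (Fin.snoc z (β (z 0))) = F ![z 0, β (z 0)] from congrFun h (β (z 0)),
    show F (Fin.snoc z (α (z 0))) = F ![z 0, α (z 0)] from congrFun h (α (z 0))]

/-- **The engine: Newton–Leibniz down a band, off a null exceptional set** (verbatim the open stub
`stub_bandNewtonLeibniz` of crux `PlanarAreas`, line `green-native-bands`). For a closed band
`{a₀ ≤ x ≤ a₁, α x ≤ y ≤ β x}` (rational `a₀ < a₁`, `ℚ`-semialgebraic `α ≤ β` on `(a₀, a₁)`), a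
`ℚ`-semialgebraic bounded `F` on the band, continuous on every closed fibre and with
`∂F/∂y = r.integrand` at every point of the open fibres outside a `ℚ`-semialgebraic null set `Z`, the
representation `r` on the band differs by relations from the base representation
`[∫_{(a₀,a₁)} F(x, β x) − F(x, α x) dx]`: two-set adapted cylindrical decomposition (`stub_fibreEqTwo`),
one `newtonLeibnizRel` instance per sub-band (`stub_subband`), telescoping (`stub_telescope`) by rule
1b, null pieces by rule 1a. [cite: KontsevichZagier2001, §1.2 rules (1),(3)] -/
theorem stub_bandNewtonLeibniz : ∀ (a₀ a₁ : ℚ) (α β : ℝ → ℝ) (F : (Fin 2 → ℝ) → ℝ)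
    (Z : Set (Fin 2 → ℝ)) (r : KZ.IntegralRep 2), a₀ < a₁ →
    IsSemialgebraicFunOn ℚ {z : Fin 1 → ℝ | z 0 ∈ Set.Ioo (a₀ : ℝ) a₁} (fun z => α (z 0)) →
    IsSemialgebraicFunOn ℚ {z : Fin 1 → ℝ | z 0 ∈ Set.Ioo (a₀ : ℝ) a₁} (fun z => β (z 0)) →
    (∀ t ∈ Set.Ioo (a₀ : ℝ) a₁, α t ≤ β t) →
    r.domain = {p : Fin 2 → ℝ | p 0 ∈ Set.Icc (a₀ : ℝ) a₁ ∧ α (p 0) ≤ p 1 ∧ p 1 ≤ β (p 0)} →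
    IsSemialgebraicFunOn ℚ r.domain F → (∃ M : ℝ, ∀ p ∈ r.domain, |F p| ≤ M) →
    (∀ t ∈ Set.Ioo (a₀ : ℝ) a₁, ContinuousOn (fun s : ℝ => F ![t, s]) (Set.Icc (α t) (β t))) →
    IsSemialgebraic ℚ Z → volume Z = 0 →
    (∀ p ∈ r.domain, p 0 ∈ Set.Ioo (a₀ : ℝ) a₁ → α (p 0) < p 1 → p 1 < β (p 0) → p ∉ Z →
      HasDerivAt (fun s : ℝ => F ![p 0, s]) (r.integrand p) (p 1)) →
    ∃ r' : KZ.IntegralRep 1, r'.domain = {z : Fin 1 → ℝ | z 0 ∈ Set.Ioo (a₀ : ℝ) a₁} ∧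
      (∀ z ∈ r'.domain, r'.integrand z = F ![z 0, β (z 0)] - F ![z 0, α (z 0)]) ∧
      KZ.of r - KZ.of r' ∈ KZ.relations := by
  intro a₀ a₁ α β F Z r _ hα hβ hαβ hdom hF hM hcont hZ hZ0 hderiv
  classical
  obtain ⟨r', hr'd, hr'i⟩ := exists_baseRep hα hβ hαβ hdom hF hM
  refine ⟨r', hr'd, hr'i, ?_⟩
  -- the open band and the adapted decomposition of the base
  set U : Set (Fin 2 → ℝ) := {p : Fin 2 → ℝ | p 0 ∈ Ioo (a₀ : ℝ) a₁ ∧ α (p 0) < p 1 ∧ p 1 < β (p 0)}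
    with hU
  have hUsa : IsSemialgebraic ℚ U := isSemialgebraic_openBand hα hβ
  obtain ⟨𝒮, l, ξ, hcd, -, hξ, hmono, hcells, hσ, hτ⟩ :=
    stub_fibreEqTwo (n := 1) (hUsa.diff hZ) (hUsa.inter hZ)
  have hpart := hcd.isPartition
  have h𝒮sa := hcd.isSemialgebraic
  -- the pieces of `r` over the cylinders and of `r'` over the cells
  let R : {C // C ∈ 𝒮} → KZ.IntegralRep 2 := fun C =>
    r.restrict (r.domain ∩ {z | Fin.init z ∈ (C : Set (Fin 1 → ℝ))})
      (r.isSemialgebraic_domain.inter (h𝒮sa C C.2).setOf_init_mem) inter_subset_left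
  let R' : {C // C ∈ 𝒮} → KZ.IntegralRep 1 := fun C =>
    r'.restrict (r'.domain ∩ (C : Set (Fin 1 → ℝ)))
      (r'.isSemialgebraic_domain.inter (h𝒮sa C C.2)) inter_subset_left
  have eR : KZ.of r - ∑ C ∈ 𝒮.attach, KZ.of (R C) ∈ KZ.relations :=
    KZ.of_sub_sum_cyl_mem_relations r 𝒮 hpart R (fun C => rfl) fun C x _ => rfl
  have eR' : KZ.of r' - ∑ C ∈ 𝒮.attach, KZ.of (R' C) ∈ KZ.relations := by
    refine KZ.of_sub_sum_of_mem_relations 𝒮.attach r' R' (fun C _ => ?_) (fun C _ x _ => rfl) ?_ ?_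
    · rw [show (R' C).domain \ r'.domain = ∅ from sdiff_eq_empty.mpr inter_subset_left, measure_empty]
    · have : r'.domain \ ⋃ C ∈ 𝒮.attach, (R' C).domain = ∅ := by
        refine sdiff_eq_empty.mpr fun z hz => ?_
        have hcov : z ∈ ⋃₀ (𝒮 : Set (Set (Fin 1 → ℝ))) := by
          rw [hpart.sUnion_eq_univ]; exact mem_univ _
        obtain ⟨C, hC, hzC⟩ := mem_sUnion.1 hcov
        exact mem_iUnion₂.2 ⟨⟨C, hC⟩, Finset.mem_attach _ _, ⟨hz, hzC⟩⟩
      rw [this, measure_empty]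
    · intro C _ C' _ hne
      have hne' : (C : Set (Fin 1 → ℝ)) ≠ C' := fun h => hne (Subtype.ext h)
      have hdisj : Disjoint (C : Set (Fin 1 → ℝ)) C' := hpart.pairwiseDisjoint C.2 C'.2 hne'
      have : (R' C).domain ∩ (R' C').domain = ∅ := by
        ext z
        simp only [mem_inter_iff, mem_empty_iff_false, iff_false, not_and]
        intro hz hz'
        exact (hdisj.ne_of_mem hz.2 hz'.2 rfl).elim
      rw [this, measure_empty]
  -- cell by cell
  have ecell : ∀ C : {C // C ∈ 𝒮}, KZ.of (R C) - KZ.of (R' C) ∈ KZ.relations := by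
    intro C
    obtain ⟨Gσ, Bσ, -, hBσ, hσfib⟩ := hσ C C.2
    obtain ⟨Gτ, Bτ, -, hBτ, hτfib⟩ := hτ C C.2
    exact stub_bandNLCell hdom hF hM hcont hderiv hα hβ hαβ hr'd hr'i hZ0 hU (h𝒮sa C C.2) (hξ C C.2)
      (hmono C C.2) (hcells C C.2).2 hBσ hσfib hBτ hτfib (R C) rfl rfl (R' C) rfl rfl
  have esum : ∑ C ∈ 𝒮.attach, KZ.of (R C) - ∑ C ∈ 𝒮.attach, KZ.of (R' C) ∈ KZ.relations :=
    KZ.sum_sub_sum_mem_relations _ _ _ fun C _ => ecell C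
  have : KZ.of r - KZ.of r' = (KZ.of r - ∑ C ∈ 𝒮.attach, KZ.of (R C)) +
      (∑ C ∈ 𝒮.attach, KZ.of (R C) - ∑ C ∈ 𝒮.attach, KZ.of (R' C)) -
      (KZ.of r' - ∑ C ∈ 𝒮.attach, KZ.of (R' C)) := by abel
  rw [this]
  exact KZ.relations.sub_mem (KZ.relations.add_mem eR esum) eR'

end Summit.KontsevichZagierPeriods.IsogenyCertificates.GenusTwoRealPeriodCellLine

end
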